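import Summits.Ventures.HSemireg.WedgeHankelFourthRegime
import Summits.Ventures.HSemireg.WedgeHankelTwoNodesRank
import Summits.Ventures.HSemireg.WedgeHankelTwoNodesShear
import Summits.Ventures.HSemireg.WedgeHankelSpikes

/-!
# Venture HSemireg — THE SYLVESTER WINDOW OF THE FOURTH REGIME IS ATTAINED, OVER EVERY FIELD, BY A SINGLE NODE: for `max(k+1, n+1−k) < D` and every `r` with
# `n + 2 − D ≤ r ≤ min(k+1, n+1−k)` the class `δ_{D−1} + δ_j` (a node at `0` of exact order `D`; `j = r − (n+2−D) − 1`, or no second spike when `r = n + 2 − D`) has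
# `rank H_k = r` — H3's window `n + 2 − D ≤ rank H_k ≤ min(k+1, n+1−k)` has no gaps, and no field-size hypothesis is needed

HONEST FRAMING. Part of the Lean index of the computation cell `pub-hsemireg` (seat p10 gen 23, Sunday typer «UNIFORM-IN-n»).
LINEAR ALGEBRA OF HANKEL (catalecticant) MATRICES over a field ONLY: no variety, no cohomology theory, no sheaf, no Ext group, no semiregularity map;
nothing here says that HC / HC_CM / HC_AV holds; no Literature fact is declared or used.  Custodian versions as in `WedgeHankelSiegelIdeal` (1/3) and `WedgeHankelFrameChange`;
the dictionary (divisor `Σ_i (P_i+1)[λ_i]` of the class `Σ_i exp(λ_i Θ)·p_i(Θ)`, total order `D = Σ_i (P_i+1)`) is QUOTED, never asserted.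

WHAT IS IN THE TREE.  H3 (`WedgeHankelFourthRegime`): `rank_hankel1_expMul_sum_window` (`n + 2 − D ≤ rank H_k ≤ min(k+1, n+1−k)` for distinct nodes, exact orders, `D > max(k+1, n+1−k)`),
with the line «NOT typed: that every value of the window is attained (it is, over a field with enough elements; field-size dependent …)»; the spike law `HankelSpikes.rank_hankel1_spikeSeq`
(`rank H_k(δ_p) = min(k,p) + 1 − (p − (n−k))`, every `p`); E10 `HankelSiegelIdeal.rank_hankel1_of_two_orders` (two nodes `0`, `∞` of orders `P+1`, `P'+1`: `min(k+1, P+P'+2)` when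
`k + P + P' + 1 ≤ n`); `expMul_zero_left` (`expMul 0 = id`).
THIS FILE (namespace `Summit.Ventures.HSemireg.Wedge.HankelFrameChange` continued): the attainment, with ONE node at `λ = 0` and therefore over EVERY field:
* §393 `hankel1_congr_of_le` (the Hankel matrix only sees `q_0, …, q_n`), `rank_hankel1_spike_top` (`D − 1 ≤ n`: `rank H_k(δ_{D−1}) = n + 2 − D`), `rank_hankel1_spike_invisible`
  (`D − 1 > n`: `rank H_k(δ_{D−1}) = 0`), `rank_hankel1_two_spikes_visible` / `rank_hankel1_two_spikes_invisible` (`rank H_k(δ_j + δ_{D−1}) = j + 1 + (n + 2 − D)`).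
* §394 **`fourth_regime_rank_attained`**: for `k ≤ n`, `max(k+1, n+1−k) < D`, `n + 2 − D ≤ r ≤ min(k+1, n+1−k)` there is `q` supported on `[0, D−1]` with `q_{D−1} ≠ 0` (a node at `0`
  of exact order `D`) and `rank (hankel1 K n k q) = r`; and in H3's literal format (`Fin 1`-indexed nodes `λ = 0`, orders `P = D − 1`, `Σ (P_i+1) = D`)
  **`fourth_regime_window_attained`**.
READING: the fourth regime's «no law» is sharp in the strongest sense — every value the Sylvester window allows occurs, already for a single higher-order node, over every field
(H3's field-size caveat concerned configurations of SIMPLE nodes only).  Nothing class-side beyond THEOREM H's translation.  New names only.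
-/

open Module

namespace Summit.Ventures.HSemireg.Wedge.HankelFrameChange

open Summit.Ventures.HSemireg.Wedge Summit.Ventures.HSemireg.Wedge.Kunneth Summit.Ventures.HSemireg.Wedge.Hankel
  Summit.Ventures.HSemireg.Wedge.HankelSpikes

variable (K : Type*) [Field K] {n : ℕ}

/-! ## §393. Spikes in and beyond the window -/

omit [Field K] in
/-- the Hankel matrix `H_k(q)` only sees `q_0, …, q_n`. -/
theorem hankel1_congr_of_le {k : ℕ} {q q' : ℕ → K} (h : ∀ t ≤ n, q t = q' t) : hankel1 K n k q = hankel1 K n k q' := by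
  ext i s
  simp only [hankel1, Matrix.of_apply]
  exact h _ (by have := i.2; have := s.2; omega)

/-- **`rank H_k(δ_{D−1}) = n + 2 − D`** for `max(k+1, n+1−k) < D` (truncated: `0` once `D ≥ n + 2`) — the bottom of the window. -/
theorem rank_hankel1_spike_top {k D : ℕ} (hk : k ≤ n) (hD : max (k + 1) (n + 1 - k) < D) : (hankel1 K n k (spikeSeq K (D - 1))).rank = n + 2 - D := by
  rw [rank_hankel1_spikeSeq K hk (D - 1)]
  have h1 : k + 1 < D := lt_of_le_of_lt (le_max_left _ _) hD
  have h2 : n + 1 - k < D := lt_of_le_of_lt (le_max_right _ _) hD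
  rw [min_eq_left (by omega : k ≤ D - 1)]
  omega

/-- two spikes `δ_j + δ_{D−1}` with `D − 1 ≤ n` and `j + k + 1 ≤ D − 1`: a node at `0` of order `j + 1` and a node at `∞` of order `n + 2 − D` (E10), so
**`rank H_k(δ_j + δ_{D−1}) = min(k+1, j + 1 + (n + 2 − D))`.** -/
theorem rank_hankel1_two_spikes_visible {k D j : ℕ} (hDn : D - 1 ≤ n) (hj : j + k + 1 ≤ D - 1) :
    (hankel1 K n k (spikeSeq K j + spikeSeq K (D - 1))).rank = min (k + 1) (j + (n - (D - 1)) + 2) := by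
  have h := HankelSiegelIdeal.rank_hankel1_of_two_orders K (n := n) (k := k) (P := j) (P' := n - (D - 1)) (by omega)
    (q := spikeSeq K j + spikeSeq K (D - 1)) (fun t ht ht' => by
      simp only [Pi.add_apply, spikeSeq_apply]
      rw [if_neg (by omega), if_neg (by omega), add_zero])
    (by simp [spikeSeq_apply, show j ≠ D - 1 by omega])
    (by rw [show n - (n - (D - 1)) = D - 1 by omega]; simp [spikeSeq_apply, show D - 1 ≠ j by omega])
  exact h

/-- two spikes `δ_j + δ_{D−1}` with `D − 1 > n`: the second is invisible to `H_k`, so **`rank H_k(δ_j + δ_{D−1}) = rank H_k(δ_j) = min(k,j) + 1 − (j − (n−k))`.** -/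
theorem rank_hankel1_two_spikes_invisible {k D j : ℕ} (hk : k ≤ n) (hDn : n < D - 1) :
    (hankel1 K n k (spikeSeq K j + spikeSeq K (D - 1))).rank = min k j + 1 - (j - (n - k)) := by
  rw [hankel1_congr_of_le K (q' := spikeSeq K j) (fun t ht => by simp only [Pi.add_apply, spikeSeq_apply]; rw [if_neg (show t ≠ D - 1 by omega), add_zero]),
    rank_hankel1_spikeSeq K hk j]

/-! ## §394. Every value of the window is attained by one node -/

/-- **EVERY VALUE OF THE SYLVESTER WINDOW IS ATTAINED BY A SINGLE NODE AT `0`, OVER EVERY FIELD**: for `k ≤ n`, `max(k+1, n+1−k) < D` and `n + 2 − D ≤ r ≤ min(k+1, n+1−k)` there is a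
sequence `q` supported on `[0, D−1]` with `q_{D−1} ≠ 0` (exact order `D` at the node `0`) and `rank H_k(q) = r` — namely `δ_{D−1}` if `r = n + 2 − D`, else `δ_j + δ_{D−1}` with
`j = r − (n + 2 − D) − 1`. -/
theorem fourth_regime_rank_attained {k D r : ℕ} (hk : k ≤ n) (hD : max (k + 1) (n + 1 - k) < D) (hrlo : n + 2 - D ≤ r) (hrhi : r ≤ min (k + 1) (n + 1 - k)) :
    ∃ q : ℕ → K, (∀ t, D - 1 < t → q t = 0) ∧ q (D - 1) ≠ 0 ∧ (hankel1 K n k q).rank = r := by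
  have h1 : k + 1 < D := lt_of_le_of_lt (le_max_left _ _) hD
  have h2 : n + 1 - k < D := lt_of_le_of_lt (le_max_right _ _) hD
  have hr1 : r ≤ k + 1 := le_trans hrhi (min_le_left _ _)
  have hr2 : r ≤ n + 1 - k := le_trans hrhi (min_le_right _ _)
  by_cases hr : r = n + 2 - D
  · -- the bottom of the window: one spike at the top of the support
    refine ⟨spikeSeq K (D - 1), fun t ht => by rw [spikeSeq_apply, if_neg (by omega)], by rw [spikeSeq_apply, if_pos rfl]; exact one_ne_zero, ?_⟩
    rw [rank_hankel1_spike_top K hk hD, hr]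
  · -- add a node at `0` of order `j + 1`
    set j := r - (n + 2 - D) - 1 with hj
    have hjr : j + 1 + (n + 2 - D) = r := by omega
    have hjD : j < D - 1 := by omega
    refine ⟨spikeSeq K j + spikeSeq K (D - 1), fun t ht => ?_, ?_, ?_⟩
    · simp only [Pi.add_apply, spikeSeq_apply]
      rw [if_neg (by omega), if_neg (by omega), add_zero]
    · simp [spikeSeq_apply, show D - 1 ≠ j by omega]
    · by_cases hDn : D - 1 ≤ n
      · rw [rank_hankel1_two_spikes_visible K hDn (by omega)]
        omega
      · rw [rank_hankel1_two_spikes_invisible K hk (by omega)]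
        omega

/-- **H3's WINDOW HAS NO GAPS (literal format)**: in the fourth regime every `r` with `n + 2 − D ≤ r ≤ min(k+1, n+1−k)` is the rank `rank H_k(Σ_i expMul λ_i q_i)` of a divisor class
with distinct nodes `λ_i`, exact orders `P_i` and `Σ_i (P_i + 1) = D` — here ONE node `λ = 0` of order `D`, so no condition on the field. -/
theorem fourth_regime_window_attained {k D r : ℕ} (hk : k ≤ n) (hD : max (k + 1) (n + 1 - k) < D) (hrlo : n + 2 - D ≤ r) (hrhi : r ≤ min (k + 1) (n + 1 - k)) :
    ∃ (lam : Fin 1 → K) (P : Fin 1 → ℕ) (q : Fin 1 → ℕ → K), Function.Injective lam ∧ (∀ i t, P i < t → q i t = 0) ∧ (∀ i, q i (P i) ≠ 0) ∧ ∑ i, (P i + 1) = D ∧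
      (hankel1 K n k (fun t => ∑ i, expMul K (lam i) (q i) t)).rank = r := by
  obtain ⟨q, hq, hqP, hrank⟩ := fourth_regime_rank_attained K hk hD hrlo hrhi
  have h1 : k + 1 < D := lt_of_le_of_lt (le_max_left _ _) hD
  refine ⟨fun _ => 0, fun _ => D - 1, fun _ => q, fun i j _ => Subsingleton.elim i j, fun _ t ht => hq t ht, fun _ => hqP, by simp; omega, ?_⟩
  have hfun : (fun t => ∑ i : Fin 1, expMul K ((fun _ : Fin 1 => (0 : K)) i) ((fun _ : Fin 1 => q) i) t) = q := by
    funext t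
    rw [Fin.sum_univ_one, expMul_zero_left]
  rw [hfun, hrank]

end Summit.Ventures.HSemireg.Wedge.HankelFrameChange
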